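import Literature.NumberTheory.Automorphic.UnitaryGroupSingularBorelSiegelCover
import Literature.NumberTheory.Automorphic.UnitaryGroupSingularHeisenbergFibre
import Literature.NumberTheory.Automorphic.UnitaryGroupRationalBorelCoveringWeights
import HarnessLib

/-!
# The exact product covering weight `1_{Ω_Z}(n_b) · w_T(t_b)` of `Λ_B = B_{γ₀}(F)` on `B(𝔸_F)` at the singular
# Borel class of `U(J₃)`
(Rogawski, *Automorphic Representations of Unitary Groups in Three Variables* (1990), §7.2 Prop. 7.2.1 and
(7.2.3), pp. 92–93: `∫_{𝐙 B_γ(F)∖𝐆} = ∫_K ∫_{M(F)∖M(𝔸)} ∫_{N_γ(F)∖N(𝔸)}` with `B_γ = M N_γ`; Arthur, Duke Math. J. 45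
(1978), §1, §8.)

Topic `NumberTheory/Automorphic`; namespace `Literature.NumberTheory.Automorphic.UnitaryGroup`. THEOREMS ONLY over
accepted tree modules: no definition, no named fact, no instance, no notation, no `sorry`. Brick (c5)(9) «EXACT
PRODUCT COVERING WEIGHT FOR `Λ_B`» of row (L5-iii-c) «PROP. 7.2.2 EVALUATION» of the T1-qs LAW 5 road
(`Cruxes/H413/Lines/F0_T1InnerFormTraceIdentity.lean`): the weight `w` fed to ★ (F1)
`exists_weight_iwasawa_kAverage_of_le` (`UnitaryGroupIwasawaSubgroupWeightExchange`) when the VALUE (not a bound) of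
the singular term is computed — the product shape is what ★ (G-c) `integral_indicatorProductWeight_smul_eq_of_coord`
and ★ `UnitaryGroupSingularHeisenbergFibreBox` consume (the Siegel cover of ★ `UnitaryGroupSingularBorelSiegelCover`
dominates but does not sum to `1`).

Letters (those of ★ (F1) and ★ `lintegral_weight_mul_enorm_singularBracket_lt_top`): `Λ := arithmeticBorel ⊓
centralizer {γ₀} ≤ G(F)` (`= B_{γ₀}(F)`, `γ₀ = ι(d(a,b,a))`, `a ≠ b`), `Λ♯ := Λ.map subtype ≤ G(𝔸_F)`,
`Λ_B := Λ♯.subgroupOf B(𝔸_F) ≤ B(𝔸_F)`; `t_b = torusPart b`, `n_b = b t_b⁻¹`.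

* §1 — a `Λ`-EDITION of ★ (L2-w) `UnitaryGroupRationalBorelCoveringWeights` §3–§4, for ANY subgroup
  `Λ_B ≤ B(𝔸_F)` closed under `torusPart` (all `N`): the Levi bijection
  `exists_equiv_subgroupOf_torus_prod_unipotent_of` (`Λ_B ≃ (Λ_B ∩ T) × (Λ_B ∩ N)`, `(τ, ν) ↦ ν τ`), and
  **`isCoveringWeight_of_unipotent_of_torus`**: for covering weights `w_N` of `Λ_B ∩ N(𝔸)` and `w_T` of `Λ_B ∩ T(𝔸)`,
  `w(b) := w_N(n_b) · w_T(t_b)` is a covering weight of `Λ_B` (proof verbatim that of ★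
  `isCoveringWeight_borel_of_unipotent_of_torus`); `isCoveringWeight_indicator_mul_of` (`w_N = 1_Ω`, `Ω` strict).
* §2 — the instance `Λ = B_{γ₀}(F)` of `U(J₃)`: `torusPart_mem_singularBorelLattice` (`Λ_B` is closed under
  `torusPart`: ★ `torusPart_mem_arithmeticSubgroup`, ★ `torus_coe_mem_borelCentralizer`),
  `singularBorelLattice_subgroupOf_torusInBorel_eq` (`Λ_B ∩ T(𝔸) = T(F)_T`, so the torus weights `w_T` of ★ (C-P) /
  ★ `singularTorusStage_eq_linear` serve), `eq_heisElt_of_mem_singularBorelLattice_unipotent` (`Λ_B ∩ N(𝔸) = n(E⁻)`,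
  ★ `coe_eq_heisChart_coordY_of_mem_unipotent_centralizer`), **`existsUnique_smul_mem_centreBox`**: the centre box
  `Ω_Z := {n : y(n) ∈ 𝓕⁻}` is a STRICT fundamental set of `Λ_B ∩ N(𝔸) = N_{γ₀}(F)` (★
  `existsUnique_vadd_mem_traceZeroFundamentalDomain`), `centreBox_eq_image_heisHomeomorph`
  (`Ω_Z = heisHomeomorph '' (univ ×ˢ 𝓕⁻)`, the letter of ★ `UnitaryGroupSingularHeisenbergFibreBox`), and the HEAD
  **`isCoveringWeight_singularBorelLattice_indicator_mul`**: for every covering weight `w_T` of `T(F)_T` on `T(𝔸_F)`,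
  `b ↦ 1_{Ω_Z}(n_b) · w_T(t_b)` is a covering weight of `Λ_B` on `B(𝔸_F)`.

## References
* J. D. Rogawski, *Automorphic Representations of Unitary Groups in Three Variables*, Ann. of Math. Stud. 123 (1990),
  §1.10, §7.2 Prop. 7.2.1, (7.2.3) [Rogawski1990].
* J. Arthur, *A trace formula for reductive groups I*, Duke Math. J. 45 (1978), §1, §8 [Arthur1978TraceFormulaI].
-/

set_option autoImplicit false

noncomputable section

open MeasureTheory NumberField IsDedekindDomain Topology Set Literature.MeasureTheory.Group
open scoped ENNReal NNReal Pointwise MatrixGroups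

namespace Literature.NumberTheory.Automorphic

namespace UnitaryGroup

variable {F E : Type} [Field F] [NumberField F] [Field E] [NumberField E] [Algebra F E]
  {c : E ≃ₐ[F] E} {N : ℕ}

/-! ## §1 The product weight for a subgroup `Λ_B ≤ B(𝔸_F)` closed under `torusPart` -/

section General

variable {ΛB : Subgroup (borelAdelic F E c N)} (hΛt : ∀ β ∈ ΛB, torusPart β ∈ ΛB)

include hΛt

/-- For `Λ_B` closed under `torusPart`, the torus part of `β ∈ Λ_B` lies in `Λ_B ∩ T(𝔸_F)`. [cite: Rogawski1990, §1.10] -/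
theorem torusPart_mem_subgroupOf_torusInBorel_of {β : borelAdelic F E c N} (hβ : β ∈ ΛB) :
    (⟨torusPart β, torusPart_mem_torusAdelic β⟩ : torusInBorel F E c N) ∈ ΛB.subgroupOf (torusInBorel F E c N) :=
  Subgroup.mem_subgroupOf.2 (hΛt β hβ)

/-- For `Λ_B` closed under `torusPart`, the unipotent part `β (torusPart β)⁻¹` of `β ∈ Λ_B` lies in `Λ_B ∩ N(𝔸_F)`.
[cite: Rogawski1990, §1.10] -/
theorem mul_torusPart_inv_mem_subgroupOf_unipotentInBorel_of {β : borelAdelic F E c N} (hβ : β ∈ ΛB) :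
    (⟨β * (torusPart β)⁻¹, mul_torusPart_inv_mem_unipotentInBorel β⟩ : unipotentInBorel F E c N) ∈
      ΛB.subgroupOf (unipotentInBorel F E c N) :=
  Subgroup.mem_subgroupOf.2 (ΛB.mul_mem hβ (ΛB.inv_mem (hΛt β hβ)))

/-- **`Λ_B = (Λ_B ∩ N) · (Λ_B ∩ T)` with uniqueness** for `Λ_B` closed under `torusPart`: a bijection
`e : (Λ_B ∩ T) × (Λ_B ∩ N) ≃ Λ_B` with `e (τ, ν) = ν τ` in `B(𝔸_F)` (Λ-edition of ★
`exists_equiv_subgroupOf_torus_prod_unipotent`). [cite: Rogawski1990, §1.10, §7.2 (p. 92: `B_γ = M N_γ`)] -/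
theorem exists_equiv_subgroupOf_torus_prod_unipotent_of :
    ∃ e : ΛB.subgroupOf (torusInBorel F E c N) × ΛB.subgroupOf (unipotentInBorel F E c N) ≃ ΛB,
      ∀ p, ((e p : ΛB) : borelAdelic F E c N) =
        ((p.2 : unipotentInBorel F E c N) : borelAdelic F E c N) * ((p.1 : torusInBorel F E c N) : borelAdelic F E c N) := by
  let m : ΛB.subgroupOf (torusInBorel F E c N) × ΛB.subgroupOf (unipotentInBorel F E c N) → ΛB := fun p =>
    ⟨((p.2 : unipotentInBorel F E c N) : borelAdelic F E c N) * ((p.1 : torusInBorel F E c N) : borelAdelic F E c N),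
      ΛB.mul_mem (Subgroup.mem_subgroupOf.1 p.2.2) (Subgroup.mem_subgroupOf.1 p.1.2)⟩
  refine ⟨Equiv.ofBijective m ⟨?_, ?_⟩, fun p => rfl⟩
  · rintro ⟨τ, ν⟩ ⟨τ', ν'⟩ h
    have h1 : ((ν : unipotentInBorel F E c N) : borelAdelic F E c N) * ((τ : torusInBorel F E c N) : borelAdelic F E c N) =
        ((ν' : unipotentInBorel F E c N) : borelAdelic F E c N) * ((τ' : torusInBorel F E c N) : borelAdelic F E c N) :=
      congrArg Subtype.val h
    have ht : ((τ : torusInBorel F E c N) : borelAdelic F E c N) = ((τ' : torusInBorel F E c N) : borelAdelic F E c N) := by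
      rw [← torusPart_unipotent_mul_torus (ν : unipotentInBorel F E c N) (τ : torusInBorel F E c N), h1,
        torusPart_unipotent_mul_torus]
    have hn : ((ν : unipotentInBorel F E c N) : borelAdelic F E c N) = ((ν' : unipotentInBorel F E c N) : borelAdelic F E c N) := by
      rw [ht] at h1
      exact mul_right_cancel h1
    exact Prod.ext (Subtype.ext (Subtype.ext ht)) (Subtype.ext (Subtype.ext hn))
  · intro β
    refine ⟨(⟨⟨torusPart (β : borelAdelic F E c N), torusPart_mem_torusAdelic _⟩,
        torusPart_mem_subgroupOf_torusInBorel_of hΛt β.2⟩,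
      ⟨⟨(β : borelAdelic F E c N) * (torusPart (β : borelAdelic F E c N))⁻¹, mul_torusPart_inv_mem_unipotentInBorel _⟩,
        mul_torusPart_inv_mem_subgroupOf_unipotentInBorel_of hΛt β.2⟩), Subtype.ext ?_⟩
    change (β : borelAdelic F E c N) * (torusPart (β : borelAdelic F E c N))⁻¹ * torusPart (β : borelAdelic F E c N) =
      (β : borelAdelic F E c N)
    rw [inv_mul_cancel_right]

variable [MeasurableSpace (quasiSplit F E c N).Adelic] [BorelSpace (quasiSplit F E c N).Adelic]

/-- **THE PRODUCT WEIGHT FOR `Λ_B`** (Λ-edition of ★ `isCoveringWeight_borel_of_unipotent_of_torus`): for `Λ_B ≤ B(𝔸_F)`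
closed under `torusPart` and ANY covering weights `w_N` of `Λ_B ∩ N(𝔸_F)` on `N(𝔸_F)` and `w_T` of `Λ_B ∩ T(𝔸_F)` on
`T(𝔸_F)`, `w(b) := w_N(b (torusPart b)⁻¹) · w_T(torusPart b)` is a covering weight of `Λ_B` on `B(𝔸_F)`:
`Σ_{β = ν τ} w(β b) = Σ_τ w_T(τ t_b) · Σ_ν w_N(ν · τ n_b τ⁻¹) = 1`.
[cite: Arthur1978TraceFormulaI, §1] [cite: Rogawski1990, §7.2 (7.2.3) (p. 93)] -/
theorem isCoveringWeight_of_unipotent_of_torus {wN : unipotentInBorel F E c N → ℝ≥0∞}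
    (hwN : IsCoveringWeight (ΛB.subgroupOf (unipotentInBorel F E c N)) wN)
    {wT : torusInBorel F E c N → ℝ≥0∞} (hwT : IsCoveringWeight (ΛB.subgroupOf (torusInBorel F E c N)) wT) :
    IsCoveringWeight ΛB
      (fun b : borelAdelic F E c N =>
        wN ⟨b * (torusPart b)⁻¹, mul_torusPart_inv_mem_unipotentInBorel b⟩ *
          wT ⟨torusPart b, torusPart_mem_torusAdelic b⟩) := by
  refine ⟨(hwN.measurable.comp measurable_mul_torusPart_inv).mul (hwT.measurable.comp measurable_torusPart_mk),
    fun b => ?_⟩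
  obtain ⟨e, he⟩ := exists_equiv_subgroupOf_torus_prod_unipotent_of (F := F) (E := E) (c := c) (N := N) hΛt
  set n' : torusInBorel F E c N → unipotentInBorel F E c N := fun τ =>
    ⟨(τ : borelAdelic F E c N) * (b * (torusPart b)⁻¹) * (τ : borelAdelic F E c N)⁻¹,
      mul_mul_inv_mem_unipotentInBorel _ (mul_torusPart_inv_mem_unipotentInBorel b)⟩ with hn'
  set t' : torusInBorel F E c N := ⟨torusPart b, torusPart_mem_torusAdelic b⟩ with ht'
  rw [coveringSum_apply]
  calc ∑' β : ΛB,
        wN ⟨β • b * (torusPart (β • b))⁻¹, mul_torusPart_inv_mem_unipotentInBorel _⟩ *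
          wT ⟨torusPart (β • b), torusPart_mem_torusAdelic _⟩
      = ∑' p : ΛB.subgroupOf (torusInBorel F E c N) × ΛB.subgroupOf (unipotentInBorel F E c N),
          wN ⟨e p • b * (torusPart (e p • b))⁻¹, mul_torusPart_inv_mem_unipotentInBorel _⟩ *
            wT ⟨torusPart (e p • b), torusPart_mem_torusAdelic _⟩ :=
        (Equiv.tsum_eq e (fun β : ΛB =>
          wN ⟨β • b * (torusPart (β • b))⁻¹, mul_torusPart_inv_mem_unipotentInBorel _⟩ *
            wT ⟨torusPart (β • b), torusPart_mem_torusAdelic _⟩)).symm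
    _ = ∑' p : ΛB.subgroupOf (torusInBorel F E c N) × ΛB.subgroupOf (unipotentInBorel F E c N),
          wN (p.2 • n' (p.1 : torusInBorel F E c N)) * wT (p.1 • t') := by
        refine tsum_congr fun p => ?_
        have hsmul : e p • b = (((p.2 : unipotentInBorel F E c N) : borelAdelic F E c N)) *
            ((p.1 : torusInBorel F E c N) : borelAdelic F E c N) * b := by
          rw [Subgroup.smul_def, smul_eq_mul, he p]
        simp only [hsmul]
        rw [productWeight_apply_unipotent_mul_torus_mul]
        rfl
    _ = ∑' (τ : ΛB.subgroupOf (torusInBorel F E c N)) (ν : ΛB.subgroupOf (unipotentInBorel F E c N)),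
          wN (ν • n' (τ : torusInBorel F E c N)) * wT (τ • t') :=
        ENNReal.tsum_prod (f := fun (τ : ΛB.subgroupOf (torusInBorel F E c N))
          (ν : ΛB.subgroupOf (unipotentInBorel F E c N)) => wN (ν • n' (τ : torusInBorel F E c N)) * wT (τ • t'))
    _ = ∑' τ : ΛB.subgroupOf (torusInBorel F E c N),
          coveringSum (ΛB.subgroupOf (unipotentInBorel F E c N)) wN (n' (τ : torusInBorel F E c N)) * wT (τ • t') := by
        refine tsum_congr fun τ => ?_
        rw [ENNReal.tsum_mul_right, coveringSum_apply]
    _ = ∑' τ : ΛB.subgroupOf (torusInBorel F E c N), wT (τ • t') := by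
        refine tsum_congr fun τ => ?_
        rw [hwN.coveringSum_eq, one_mul]
    _ = 1 := by rw [← coveringSum_apply]; exact hwT.coveringSum_eq t'

/-- **The product weight with an indicator, for `Λ_B`**: for a STRICT measurable fundamental set `Ω ⊆ N(𝔸_F)` of
`Λ_B ∩ N(𝔸_F)` and a covering weight `w_T` of `Λ_B ∩ T(𝔸_F)`, `b ↦ 1_Ω(b (torusPart b)⁻¹) · w_T(torusPart b)` is a
covering weight of `Λ_B` on `B(𝔸_F)` (★ `isCoveringWeight_indicator`). [cite: Arthur1978TraceFormulaI, §1] -/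
theorem isCoveringWeight_indicator_mul_of {Ω : Set (unipotentInBorel F E c N)} (hΩ : MeasurableSet Ω)
    (hΩu : ∀ n : unipotentInBorel F E c N, ∃! ν : ΛB.subgroupOf (unipotentInBorel F E c N), ν • n ∈ Ω)
    {wT : torusInBorel F E c N → ℝ≥0∞} (hwT : IsCoveringWeight (ΛB.subgroupOf (torusInBorel F E c N)) wT) :
    IsCoveringWeight ΛB
      (fun b : borelAdelic F E c N =>
        Ω.indicator (1 : unipotentInBorel F E c N → ℝ≥0∞) ⟨b * (torusPart b)⁻¹, mul_torusPart_inv_mem_unipotentInBorel b⟩ *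
          wT ⟨torusPart b, torusPart_mem_torusAdelic b⟩) :=
  isCoveringWeight_of_unipotent_of_torus hΛt (isCoveringWeight_indicator hΩ hΩu) hwT

end General

/-! ## §2 The instance `Λ = B_{γ₀}(F)` of `U(J₃)`: `Λ_B ∩ T = T(F)_T`, `Λ_B ∩ N = n(E⁻)`, the centre box is strict -/

/-- **`Λ_B = B_{γ₀}(F)♯ ∩ B(𝔸_F)` is closed under `torusPart`**: the torus part of a rational Borel element is rational
(★ `torusPart_mem_arithmeticSubgroup`) and, being diagonal, commutes with `γ₀ = ι(d(a,b,a))` (★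
`torus_coe_mem_borelCentralizer`). [cite: Rogawski1990, §7.2 Prop. 7.2.1 (p. 92: `B_γ = M N_γ`)] -/
theorem torusPart_mem_singularBorelLattice {a b : Eˣ} {g₀ : (quasiSplit F E c 3).Rational}
    {γ₀ : (quasiSplit F E c 3).arithmeticSubgroup}
    (hg₀ : ((g₀.val : GL (Fin 3) E) : Matrix (Fin 3) (Fin 3) E) = !![(a : E), 0, 0; 0, b, 0; 0, 0, a])
    (hγ₀ : (γ₀ : (quasiSplit F E c 3).Adelic) = (quasiSplit F E c 3).toAdelic g₀) :
    ∀ β ∈ ((arithmeticBorel F E c 3 ⊓ Subgroup.centralizer ({γ₀} : Set (quasiSplit F E c 3).arithmeticSubgroup)).map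
        (quasiSplit F E c 3).arithmeticSubgroup.subtype).subgroupOf (borelAdelic F E c 3),
      torusPart β ∈ ((arithmeticBorel F E c 3 ⊓ Subgroup.centralizer ({γ₀} : Set (quasiSplit F E c 3).arithmeticSubgroup)).map
        (quasiSplit F E c 3).arithmeticSubgroup.subtype).subgroupOf (borelAdelic F E c 3) := by
  intro β hβ
  have hβrat : ((β : borelAdelic F E c 3) : (quasiSplit F E c 3).Adelic) ∈ (quasiSplit F E c 3).arithmeticSubgroup := by
    obtain ⟨h, -⟩ := (mem_map_subtype_subgroup_iff _ _).1 (Subgroup.mem_subgroupOf.1 hβ)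
    exact h
  exact Subgroup.mem_subgroupOf.2
    (torus_coe_mem_borelCentralizer hg₀ hγ₀ (torusPart_mem_arithmeticSubgroup hβrat) (torusPart_torusPart β))

/-- **`Λ_B ∩ T(𝔸_F) = T(F)_T`**: a torus element of `B(𝔸_F)` lies in `B_{γ₀}(F)♯` iff it is rational (★
`torus_coe_mem_borelCentralizer`); so the torus covering weights of `T(F)_T = B(F)_B ∩ T(𝔸_F)` (★ `rationalBorel`) are
exactly those of `Λ_B ∩ T(𝔸_F)`. [cite: Rogawski1990, §7.2 Prop. 7.2.1 (p. 92)] -/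
theorem singularBorelLattice_subgroupOf_torusInBorel_eq {a b : Eˣ} {g₀ : (quasiSplit F E c 3).Rational}
    {γ₀ : (quasiSplit F E c 3).arithmeticSubgroup}
    (hg₀ : ((g₀.val : GL (Fin 3) E) : Matrix (Fin 3) (Fin 3) E) = !![(a : E), 0, 0; 0, b, 0; 0, 0, a])
    (hγ₀ : (γ₀ : (quasiSplit F E c 3).Adelic) = (quasiSplit F E c 3).toAdelic g₀) :
    (((arithmeticBorel F E c 3 ⊓ Subgroup.centralizer ({γ₀} : Set (quasiSplit F E c 3).arithmeticSubgroup)).map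
        (quasiSplit F E c 3).arithmeticSubgroup.subtype).subgroupOf (borelAdelic F E c 3)).subgroupOf (torusInBorel F E c 3) =
      (rationalBorel F E c 3).subgroupOf (torusInBorel F E c 3) := by
  ext t
  simp only [Subgroup.mem_subgroupOf]
  constructor
  · intro ht
    obtain ⟨h, -⟩ := (mem_map_subtype_subgroup_iff _ _).1 ht
    exact h
  · intro ht
    exact torus_coe_mem_borelCentralizer hg₀ hγ₀ ht ((mem_torusInBorel_iff_torusPart_eq _).1 t.2)

/-- **`Λ_B ∩ N(𝔸_F) = n(E⁻)`**: an element of `N(𝔸_F)` lying in `B_{γ₀}(F)♯` is a rational unipotent element commuting with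
`γ₀`, hence a centre element `n(w) = heisElt hc 0 w` with `w ∈ E⁻` (★ `coe_eq_heisChart_coordY_of_mem_unipotent_centralizer`).
[cite: Rogawski1990, §7.2 Prop. 7.2.1 (p. 92: `N_γ = Z` for `γ = d(a,b,a)`)] -/
theorem eq_heisElt_of_mem_singularBorelLattice_unipotent (hc : c * c = 1) {a b : Eˣ} (hab : (a : E) ≠ (b : E))
    {g₀ : (quasiSplit F E c 3).Rational} {γ₀ : (quasiSplit F E c 3).arithmeticSubgroup}
    (hg₀ : ((g₀.val : GL (Fin 3) E) : Matrix (Fin 3) (Fin 3) E) = !![(a : E), 0, 0; 0, b, 0; 0, 0, a])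
    (hγ₀ : (γ₀ : (quasiSplit F E c 3).Adelic) = (quasiSplit F E c 3).toAdelic g₀)
    {ν : unipotentInBorel F E c 3}
    (hν : ν ∈ (((arithmeticBorel F E c 3 ⊓ Subgroup.centralizer ({γ₀} : Set (quasiSplit F E c 3).arithmeticSubgroup)).map
        (quasiSplit F E c 3).arithmeticSubgroup.subtype).subgroupOf (borelAdelic F E c 3)).subgroupOf (unipotentInBorel F E c 3)) :
    ∃ w : rationalTraceZero F E c, ν = heisElt hc 0 (w : traceZeroAdele F E c) := by
  obtain ⟨hrat, hΛ⟩ := (mem_map_subtype_subgroup_iff _ _).1 (Subgroup.mem_subgroupOf.1 (Subgroup.mem_subgroupOf.1 hν))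
  set n : (quasiSplit F E c 3).arithmeticSubgroup :=
    ⟨(((ν : unipotentInBorel F E c 3) : borelAdelic F E c 3) : (quasiSplit F E c 3).Adelic), hrat⟩ with hn
  have hnmem : n ∈ (adelicUnipotent F E c 3).subgroupOf (quasiSplit F E c 3).arithmeticSubgroup ⊓
      Subgroup.centralizer ({γ₀} : Set (quasiSplit F E c 3).arithmeticSubgroup) :=
    Subgroup.mem_inf.2 ⟨Subgroup.mem_subgroupOf.2 ((mem_unipotentInBorel_iff _).1 ν.2), (Subgroup.mem_inf.1 hΛ).2⟩
  obtain ⟨-, -, hy, hcoe⟩ := coe_eq_heisChart_coordY_of_mem_unipotent_centralizer hc hab hg₀ hγ₀ hnmem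
  refine ⟨⟨_, hy⟩, Subtype.ext (Subtype.ext ?_)⟩
  exact hcoe

/-- `y(n(w) · n) = w + y(n)` for a centre element `n(w)` (★ `coe_heisY_mul`, `x(n(w)) = 0`).
[cite: Rogawski1990, §1.10] -/
theorem heisY_heisElt_zero_mul (hc : c * c = 1) (w : rationalTraceZero F E c) (n : unipotentInBorel F E c 3) :
    heisY hc (heisElt hc 0 (w : traceZeroAdele F E c) * n) = w +ᵥ heisY hc n := by
  have hy : (heisY hc (heisElt hc 0 (w : traceZeroAdele F E c) * n) : AdeleRing (𝓞 E) E) =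
      ((w : traceZeroAdele F E c) : AdeleRing (𝓞 E) E) + (heisY hc n : AdeleRing (𝓞 E) E) := by
    rw [coe_heisY_mul hc, heisX_heisElt, heisY_heisElt, map_zero, mul_zero, zero_mul, sub_self, mul_zero, add_zero]
  exact Subtype.ext (by rw [hy]; rfl)

/-- **THE CENTRE BOX `Ω_Z = {n ∈ N(𝔸_F) : y(n) ∈ 𝓕⁻}` IS A STRICT FUNDAMENTAL SET OF `Λ_B ∩ N(𝔸_F) = N_{γ₀}(F)`**: for
every `n ∈ N(𝔸_F)` there is exactly one `ν ∈ Λ_B ∩ N(𝔸_F)` with `y(ν n) ∈ 𝓕⁻` — `ν = n(w)` with `w ∈ E⁻` the unique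
lattice vector moving `y(n)` into `𝓕⁻` (★ `existsUnique_vadd_mem_traceZeroFundamentalDomain`; `y(n(w) n) = w + y(n)`).
[cite: Rogawski1990, §7.2 Prop. 7.2.1, (7.2.3) (pp. 92–93)] [cite: CasselsFrohlichANT1967, Ch. XV Thm. 4.1.3 (1)] -/
theorem existsUnique_smul_mem_centreBox (hc : c * c = 1) {a b : Eˣ} (hab : (a : E) ≠ (b : E))
    {g₀ : (quasiSplit F E c 3).Rational} {γ₀ : (quasiSplit F E c 3).arithmeticSubgroup}
    (hg₀ : ((g₀.val : GL (Fin 3) E) : Matrix (Fin 3) (Fin 3) E) = !![(a : E), 0, 0; 0, b, 0; 0, 0, a])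
    (hγ₀ : (γ₀ : (quasiSplit F E c 3).Adelic) = (quasiSplit F E c 3).toAdelic g₀) (n : unipotentInBorel F E c 3) :
    ∃! ν : (((arithmeticBorel F E c 3 ⊓ Subgroup.centralizer ({γ₀} : Set (quasiSplit F E c 3).arithmeticSubgroup)).map
        (quasiSplit F E c 3).arithmeticSubgroup.subtype).subgroupOf (borelAdelic F E c 3)).subgroupOf (unipotentInBorel F E c 3),
      ν • n ∈ {u : unipotentInBorel F E c 3 | heisY hc u ∈ traceZeroFundamentalDomain F E c} := by
  obtain ⟨w₀, hw₀, huniq⟩ := existsUnique_vadd_mem_traceZeroFundamentalDomain hc (heisY hc n)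
  -- the centre element `n(w)` as a member of `Λ_B ∩ N(𝔸_F)`
  have hmem : ∀ w : rationalTraceZero F E c, (heisElt hc 0 (w : traceZeroAdele F E c) : unipotentInBorel F E c 3) ∈
      (((arithmeticBorel F E c 3 ⊓ Subgroup.centralizer ({γ₀} : Set (quasiSplit F E c 3).arithmeticSubgroup)).map
        (quasiSplit F E c 3).arithmeticSubgroup.subtype).subgroupOf (borelAdelic F E c 3)).subgroupOf
          (unipotentInBorel F E c 3) := fun w =>
    Subgroup.mem_subgroupOf.2 (Subgroup.mem_subgroupOf.2 (heisElt_zero_coe_mem_borelCentralizer hc hg₀ hγ₀ w))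
  refine ⟨⟨heisElt hc 0 (w₀ : traceZeroAdele F E c), hmem w₀⟩, ?_, ?_⟩
  · change heisY hc (heisElt hc 0 (w₀ : traceZeroAdele F E c) * n) ∈ traceZeroFundamentalDomain F E c
    rw [heisY_heisElt_zero_mul]
    exact hw₀
  · intro ν hν
    obtain ⟨w, hw⟩ := eq_heisElt_of_mem_singularBorelLattice_unipotent hc hab hg₀ hγ₀ ν.2
    have hνn : heisY hc ((ν : unipotentInBorel F E c 3) * n) ∈ traceZeroFundamentalDomain F E c := hν
    rw [hw, heisY_heisElt_zero_mul] at hνn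
    have hww : w = w₀ := huniq w hνn
    exact Subtype.ext (by rw [hw, hww])

/-- **The centre box in the letters of ★ `UnitaryGroupSingularHeisenbergFibreBox`**: `{n : y(n) ∈ S} = heisHomeomorph ''
(univ ×ˢ S)` (the chart `(x, y) ↦ heisElt x y` has inverse `n ↦ (x(n), y(n))`). [cite: Rogawski1990, §1.10] -/
theorem centreBox_eq_image_heisHomeomorph (hc : c * c = 1) (S : Set (traceZeroAdele F E c)) :
    {u : unipotentInBorel F E c 3 | heisY hc u ∈ S} =
      heisHomeomorph hc '' ((Set.univ : Set (AdeleRing (𝓞 E) E)) ×ˢ S) := by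
  ext u
  simp only [Set.mem_setOf_eq, Set.mem_image, Set.mem_prod, Set.mem_univ, true_and, heisHomeomorph_apply]
  constructor
  · intro h
    exact ⟨(heisX u, heisY hc u), h, heisElt_heisX_heisY hc u⟩
  · rintro ⟨p, hp, rfl⟩
    rwa [heisY_heisElt]

section Head

variable [MeasurableSpace (quasiSplit F E c 3).Adelic] [BorelSpace (quasiSplit F E c 3).Adelic]
  [MeasurableSpace (AdeleRing (𝓞 E) E)] [BorelSpace (AdeleRing (𝓞 E) E)]

/-- The centre box `Ω_Z = {n : y(n) ∈ 𝓕⁻}` is measurable (`y` continuous, ★ `continuous_heisY`; `𝓕⁻` measurable, ★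
`measurableSet_traceZeroFundamentalDomain`). [cite: Rogawski1990, §1.10] -/
theorem measurableSet_centreBox (hc : c * c = 1) :
    MeasurableSet {u : unipotentInBorel F E c 3 | heisY hc u ∈ traceZeroFundamentalDomain F E c} := by
  haveI : BorelSpace (borelAdelic F E c 3) := Subtype.borelSpace _
  haveI : BorelSpace (unipotentInBorel F E c 3) := Subtype.borelSpace _
  exact (continuous_heisY hc).measurable measurableSet_traceZeroFundamentalDomain

/-- **HEAD — THE EXACT PRODUCT COVERING WEIGHT OF `Λ_B = B_{γ₀}(F)♯ ∩ B(𝔸_F)`.** For the singular base point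
`γ₀ = ι(d(a,b,a))` (`a ≠ b`) of `U(J₃)` and EVERY covering weight `w_T` of `T(F)_T` on `T(𝔸_F)`, the product
`b ↦ 1_{Ω_Z}(b (torusPart b)⁻¹) · w_T(torusPart b)`, `Ω_Z = {n : y(n) ∈ 𝓕⁻}` the centre box, is a covering weight of
`Λ_B` on `B(𝔸_F)` — the weight `w` of ★ `exists_weight_iwasawa_kAverage_of_le` at `Λ = B_{γ₀}(F)` realising the
unfolding `∫_{𝐙 B_γ(F)∖𝐆} = ∫_K ∫_{M(F)∖M(𝔸)} ∫_{N_γ(F)∖N(𝔸)}` of (7.2.3) EXACTLY (sum `= 1`, not merely `≥ 1`).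
[cite: Rogawski1990, §7.2 Prop. 7.2.1, (7.2.3) (pp. 92–93)] [cite: Arthur1978TraceFormulaI, §1, §8] -/
theorem isCoveringWeight_singularBorelLattice_indicator_mul (hc : c * c = 1) {a b : Eˣ} (hab : (a : E) ≠ (b : E))
    {g₀ : (quasiSplit F E c 3).Rational} {γ₀ : (quasiSplit F E c 3).arithmeticSubgroup}
    (hg₀ : ((g₀.val : GL (Fin 3) E) : Matrix (Fin 3) (Fin 3) E) = !![(a : E), 0, 0; 0, b, 0; 0, 0, a])
    (hγ₀ : (γ₀ : (quasiSplit F E c 3).Adelic) = (quasiSplit F E c 3).toAdelic g₀)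
    {wT : torusInBorel F E c 3 → ℝ≥0∞}
    (hwT : IsCoveringWeight ((rationalBorel F E c 3).subgroupOf (torusInBorel F E c 3)) wT) :
    IsCoveringWeight
      (((arithmeticBorel F E c 3 ⊓ Subgroup.centralizer ({γ₀} : Set (quasiSplit F E c 3).arithmeticSubgroup)).map
        (quasiSplit F E c 3).arithmeticSubgroup.subtype).subgroupOf (borelAdelic F E c 3))
      (fun b : borelAdelic F E c 3 =>
        {u : unipotentInBorel F E c 3 | heisY hc u ∈ traceZeroFundamentalDomain F E c}.indicator
            (1 : unipotentInBorel F E c 3 → ℝ≥0∞) ⟨b * (torusPart b)⁻¹, mul_torusPart_inv_mem_unipotentInBorel b⟩ *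
          wT ⟨torusPart b, torusPart_mem_torusAdelic b⟩) := by
  have hwT' : IsCoveringWeight
      ((((arithmeticBorel F E c 3 ⊓ Subgroup.centralizer ({γ₀} : Set (quasiSplit F E c 3).arithmeticSubgroup)).map
        (quasiSplit F E c 3).arithmeticSubgroup.subtype).subgroupOf (borelAdelic F E c 3)).subgroupOf (torusInBorel F E c 3)) wT := by
    rw [singularBorelLattice_subgroupOf_torusInBorel_eq hg₀ hγ₀]
    exact hwT
  exact isCoveringWeight_indicator_mul_of (torusPart_mem_singularBorelLattice hg₀ hγ₀) (measurableSet_centreBox hc)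
    (existsUnique_smul_mem_centreBox hc hab hg₀ hγ₀) hwT'

end Head

end UnitaryGroup

end Literature.NumberTheory.Automorphic
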